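import Literature.NumberTheory.GaloisRepresentations.RestrictedRamificationInflationTwo
import HarnessLib

/-!
# `ker(inf : H²(K_S/F, μ_N) → H²(F, μ_N))` dies in `H²(K_S/F, μ_{N'})` — from radical descent and
# Kummer theory over `K_S` (the `S`-ideal-class-group step of cyclotomic weak Leopoldt)

Setting (all inside the absolute Galois group `Γ_K` of a field `K`, as in the tree's
`Greenberg2006.galoisGroupAbove`): `S` a set of finite places of the number field `K`,
`N_S = ramificationSubgroup K S ⊴ Γ_K` (so `K̄^{N_S} = K_S`, `Γ_K ⧸ N_S = G_{K,S}`), `H ≤ Γ_K` a CLOSED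
subgroup with `N_S ≤ H` (`F := K̄^H ⊆ K_S`; `Gal(K_S/F) = galoisGroupAbove S H = H/N_S ≤ G_{K,S}`), and
`μ_N ↪ μ_{N'}` (`N' = N·e`) the roots of unity of `K̄` as discrete `Γ_K`-modules (`mu K N`), DESCENDED to
`Gal(K_S/F)` (a continuous representation `ρG` of `galoisGroupAbove S H` on `MuCarrier K N` with
`ρG(σ̄) = σ` for `σ ∈ H` — which exists iff `N_S` acts trivially on `μ_N`, e.g. `S ⊇ {v ∣ N}`,
`exists_continuousRep_galoisGroupAbove_mu`).

MAIN RESULT (`cohomologyMap_twoCocycleClass_eq_zero_of_radicalDescent_of_kummer`, class form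
`cohomologyMap_eq_zero_of_inflation_eq_zero_of_radicalDescent_of_kummer`): **a class
`y ∈ H²(Gal(K_S/F), μ_N)` whose inflation to `H = Gal(K̄/F)` vanishes maps to `0` in
`H²(Gal(K_S/F), μ_{N'})`**, GIVEN two arithmetic inputs stated as hypotheses (binders; they are the
business of sibling files):

* (RD) RADICAL DESCENT at `(N, N' = N e)`: for `b ∈ K_S^×` (`N_S`-fixed unit of `K̄`) such that
  `σ(b)/b ∈ (K_S^×)^N` for every `σ ∈ H`, one has `b^e = c · d^{N'}` with `c ∈ F^×` (`H`-fixed) and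
  `d ∈ K_S^×` — for a number field `F`, `S ⊇ S_p`, `N = p^m`, `e = p^t ≥` the exponent of the `p`-part
  of the `S`-class group of `F`, this is the finiteness of the class group read through Kummer theory
  (Neukirch–Schmidt–Wingberg (8.3.11) (ii): the transgression term `Cl_S(F)/p^m` of
  `H²(G_S(F), μ_{p^m})` dies under `μ_{p^m} ↪ μ_{p^{m+t}}`);
* (KUM) KUMMER THEORY OVER `K_S`: every continuous `1`-cocycle `N_S → μ_N` is `n ↦ n(β)/β` for a unit
  `β` of `K̄` (Hilbert 90 for `Gal(K̄/K_S)`, Serre X §3 (b) over the infinite extension `K_S`).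

THE COCYCLE BOOKKEEPING IN BETWEEN is this file: for a `2`-cocycle `f` of `Gal(K_S/F)` with
`f ∘ (q × q) = ∂φ` on `H` (`q : H ↠ H/N_S`), the transgression datum `x(n) = φ(n) − f(1,1)` is a
continuous HOMOMORPHISM `N_S → μ_N` (`N_S` acts trivially), `Γ`-EQUIVARIANT (`x(σnσ⁻¹) = σ·x(n)`,
tree `transgression_conj`); (KUM) writes `x(n) = n(β)/β`, `b := β^N ∈ K_S^×`; equivariance gives
`σ(β)/β ∈ K_S^×` hence `σ(b)/b ∈ (K_S^×)^N` for `σ ∈ H`; (RD) gives `b^e = c d^{N'}`, so `δ := β/d` is an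
`N'`-th root of `c ∈ F^×` and the Kummer cocycle `ψ(σ) = σ(δ)/δ` of `H` in `μ_{N'}` restricts on `N_S` to
`ι ∘ x`; the abstract lemma `cohomologyMap_twoCocycleClass_eq_zero_of_oneCocycle_extension`
(`InflationKernelCoefficientChange.lean`) concludes.  The inflation map, the inflated
cocycles, the descent `ρG` and the transgression cocycle are in the sibling
`RestrictedRamificationInflationTwo.lean` (`exists_inflation₂`, `exists_twoCocycle_inflate`,
`exists_continuousRep_galoisGroupAbove_mu`, `exists_transgression_oneCocycle`).

USE: step (B) of the proof of the WEAK LEOPOLDT CONJECTURE FOR THE CYCLOTOMIC `ℤ_p`-EXTENSION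
(Iwasawa 1973; Neukirch–Schmidt–Wingberg (10.3.25)) along the tree's route — (A) every class of
`H²(Gal(K̄/F_n), μ_{p^m})` dies on a cyclotomic layer (tree `CyclotomicKillingPrimePower`), (B) THIS
FILE + (RD) + (KUM), (C) passage to the limit over `n`, `m` (tree
`ProfiniteIntersectionCocycleExtension`, `ProfiniteIntersectionTorsionCoefficients`) — towards the
named fact `Literature.NumberTheory.IwasawaTheory.weakLeopoldt_H2_subsingleton_cyclotomic_of_isOpen`
(⟺ Greenberg 2006 / Nguyen Quang Do 1984 weak Leopoldt above the cyclotomic tower, tree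
`GoodLatticeBDPValueT4OfCyclotomic`).  HONEST FRAMING: Galois-cohomological plumbing; (RD) and (KUM)
are HYPOTHESES here, nothing arithmetic is asserted; no conjecture is proved by this file.

## References

* J. Neukirch, A. Schmidt, K. Wingberg, *Cohomology of Number Fields*, 2nd ed. (2008), (1.6.7)
  (five-term sequence), (8.3.11) (`H²(G_S, μ_{p^m})` and `Cl_S`), (10.3.25) (cyclotomic weak Leopoldt).
  [NeukirchSchmidtWingberg2008]
* K. Iwasawa, *On ℤ_ℓ-extensions of algebraic number fields*, Ann. of Math. 98 (1973) 246–326, §2.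
* J.-P. Serre, *Local Fields* (1979), X §3 (b) (Kummer theory); *Galois Cohomology* (1997), I §2.6 (b).
  [Serre1979] [SerreGaloisCohomology1997]
-/

noncomputable section

open CategoryTheory Function Topology Field NumberField IsDedekindDomain

namespace Literature.NumberTheory.GaloisRepresentations

open _root_.TopRep _root_.ContRepresentation _root_.ContinuousCohomology DiscreteGaloisModule
open Literature.NumberTheory.IwasawaTheory.Greenberg2006

variable {K : Type} [Field K] [NumberField K] (S : Set (HeightOneSpectrum (𝓞 K)))
  (H : Subgroup (absoluteGaloisGroup K))

/-! ### The main theorem -/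

/-- **MAIN THEOREM (cocycle form).**  `K` a number field, `S` a set of finite places, `H ≤ Γ_K` closed
with `N_S ≤ H`, `N·e = N'`, `ρG`/`ρG'` descended actions of `Gal(K_S/F) = galoisGroupAbove S H` on
`μ_N`/`μ_{N'}` and `J : μ_N → μ_{N'}` the inclusion as a morphism of these representations.  ASSUME
(RD) radical descent at `(N, N')` for `F = K̄^H` inside `K_S = K̄^{N_S}` and (KUM) Kummer theory for
`1`-cocycles of `N_S` in `μ_N`.  THEN for every continuous `2`-cocycle `f` of `Gal(K_S/F)` in `μ_N` whose
inflation `f ∘ (q × q)` to `H` is a coboundary `∂φ`, the class `J_*[f] ∈ H²(Gal(K_S/F), μ_{N'})`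
vanishes. [cite: NeukirchSchmidtWingberg2008, (8.3.11) (ii), (10.3.25)] [cite: Serre1979, Ch. X §3 b)] -/
theorem cohomologyMap_twoCocycleClass_eq_zero_of_radicalDescent_of_kummer
    (hH : IsClosed (H : Set (absoluteGaloisGroup K))) (hNH : ramificationSubgroup K S ≤ H)
    {N N' e : ℕ} (hNe : N * e = N')
    (hRD : ∀ b : (AlgebraicClosure K)ˣ, (∀ n ∈ ramificationSubgroup K S, n • b = b) →
      (∀ σ ∈ H, ∃ d : (AlgebraicClosure K)ˣ, (∀ n ∈ ramificationSubgroup K S, n • d = d) ∧ σ • b = b * d ^ N) →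
      ∃ c d : (AlgebraicClosure K)ˣ, (∀ σ ∈ H, σ • c = c) ∧ (∀ n ∈ ramificationSubgroup K S, n • d = d) ∧
        b ^ e = c * d ^ N')
    (hKUM : ∀ x : contOneCocycles ((mu K N).restrict (subgroupIncl (ramificationSubgroup K S))).toTopRep,
      ∃ β : (AlgebraicClosure K)ˣ, ∀ n : ramificationSubgroup K S,
        muVal K N (x.1 n) = (n : absoluteGaloisGroup K) • β / β)
    (ρG : ContinuousRep (galoisGroupAbove S H) ℤ (MuCarrier K N))
    (hρG : ∀ (σ : H) (v : MuCarrier K N),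
      ρG ⟨toUnramifiedQuot K S (σ : absoluteGaloisGroup K), coe_mem_galoisGroupAbove S H σ⟩ v =
        mu K N (σ : absoluteGaloisGroup K) v)
    (ρG' : ContinuousRep (galoisGroupAbove S H) ℤ (MuCarrier K N'))
    (hρG' : ∀ (σ : H) (v : MuCarrier K N'),
      ρG' ⟨toUnramifiedQuot K S (σ : absoluteGaloisGroup K), coe_mem_galoisGroupAbove S H σ⟩ v =
        mu K N' (σ : absoluteGaloisGroup K) v)
    (J : ρG.toTopRep ⟶ ρG'.toTopRep) (hJ : ∀ v : MuCarrier K N, J.hom v = muInclusion K ⟨e, hNe.symm⟩ v)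
    (f : contTwoCocycles ρG.toTopRep) (φ : C(H, MuCarrier K N))
    (hφ : ∀ σ τ : H,
      f.1 (⟨toUnramifiedQuot K S (σ : absoluteGaloisGroup K), coe_mem_galoisGroupAbove S H σ⟩,
          ⟨toUnramifiedQuot K S (τ : absoluteGaloisGroup K), coe_mem_galoisGroupAbove S H τ⟩) =
        mu K N (σ : absoluteGaloisGroup K) (φ τ) - φ (σ * τ) + φ σ) :
    haveI : CompactSpace (galoisGroupAbove S H) := compactSpace_galoisGroupAbove S H hH
    cohomologyMap J 2 (twoCocycleClass _ f) = 0 := by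
  haveI : CompactSpace (absoluteGaloisGroup K) := absoluteGaloisGroup_compactSpace K
  haveI : CompactSpace H := isCompact_iff_compactSpace.mp hH.isCompact
  haveI : CompactSpace (galoisGroupAbove S H) := compactSpace_galoisGroupAbove S H hH
  -- the quotient map `θ = q : H ↠ Gal(K_S/F)`
  let θ : H →ₜ* galoisGroupAbove S H :=
    { toFun := fun σ => ⟨toUnramifiedQuot K S (σ : absoluteGaloisGroup K), coe_mem_galoisGroupAbove S H σ⟩
      map_one' := Subtype.ext (by simp)
      map_mul' := fun a b => galoisGroupAbove_mk_mul S H a b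
      continuous_toFun := ((continuous_toUnramifiedQuot K S).comp continuous_subtype_val).subtype_mk _ }
  have hθ : ∀ σ : H, θ σ = ⟨toUnramifiedQuot K S (σ : absoluteGaloisGroup K), coe_mem_galoisGroupAbove S H σ⟩ :=
    fun _ => rfl
  have hq : IsQuotientMap θ :=
    θ.continuous_toFun.isClosedMap.isQuotientMap θ.continuous_toFun (galoisGroupAbove_mk_surjective S H)
  have hθN : ∀ {n : H}, θ n = 1 ↔ (n : absoluteGaloisGroup K) ∈ ramificationSubgroup K S := fun {n} =>
    galoisGroupAbove_mk_eq_one_iff S H n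
  -- (3a)'s hypothesis shape
  have hφ' : ∀ σ τ : H, f.1 (θ σ, θ τ) = ρG.toTopRep.ρ (θ σ) (φ τ) - φ (σ * τ) + φ σ := fun σ τ => by
    rw [ContinuousRep.toTopRep_ρ_apply, hθ, hρG]
    exact hφ σ τ
  -- `N_S` acts trivially on `μ_N`
  have htriv : ∀ n : absoluteGaloisGroup K, n ∈ ramificationSubgroup K S → ∀ v : MuCarrier K N, mu K N n v = v := by
    intro n hn v
    have h := hρG ⟨n, hNH hn⟩ v
    rw [show (⟨toUnramifiedQuot K S ((⟨n, hNH hn⟩ : H) : absoluteGaloisGroup K), coe_mem_galoisGroupAbove S H _⟩ :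
        galoisGroupAbove S H) = 1 from hθN.2 hn, map_one] at h
    exact h.symm
  -- §A. the transgression datum `x : N_S → μ_N` and its Kummer generator `β`
  obtain ⟨x, hx⟩ := exists_transgression_oneCocycle S H hNH ρG hρG f φ hφ
  obtain ⟨β, hβ⟩ := hKUM x
  -- `n • β = x(n) · β`
  have hnβ : ∀ (n : absoluteGaloisGroup K) (hn : n ∈ ramificationSubgroup K S),
      n • β = muVal K N (φ ⟨n, hNH hn⟩ - f.1 (1, 1)) * β := fun n hn => by
    have h := hβ ⟨n, hn⟩
    rw [hx ⟨n, hn⟩] at h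
    exact (eq_div_iff_mul_eq'.mp h).symm
  -- `b := β ^ N` is `N_S`-fixed
  set b : (AlgebraicClosure K)ˣ := β ^ N with hb
  have hbN : ∀ n ∈ ramificationSubgroup K S, n • b = b := fun n hn => by
    rw [hb, smul_pow', hnβ n hn, mul_pow, muVal_pow_eq_one, one_mul]
  -- equivariance: `σ • x(σ⁻¹ n σ) = x(n)` for `σ ∈ H`, `n ∈ N_S`
  have hequiv : ∀ (σ : H) (n : absoluteGaloisGroup K) (hn : n ∈ ramificationSubgroup K S),
      (σ : absoluteGaloisGroup K) • muVal K N (φ ⟨(σ : absoluteGaloisGroup K)⁻¹ * n * σ,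
          hNH (by simpa using Subgroup.Normal.conj_mem inferInstance n hn (σ : absoluteGaloisGroup K)⁻¹)⟩ - f.1 (1, 1)) =
        muVal K N (φ ⟨n, hNH hn⟩ - f.1 (1, 1)) := by
    intro σ n hn
    have hn₁ : (σ : absoluteGaloisGroup K)⁻¹ * n * σ ∈ ramificationSubgroup K S := by
      simpa using Subgroup.Normal.conj_mem inferInstance n hn (σ : absoluteGaloisGroup K)⁻¹
    have hn₁' : θ ⟨(σ : absoluteGaloisGroup K)⁻¹ * n * σ, hNH hn₁⟩ = 1 := hθN.2 hn₁
    have h := transgression_conj θ f φ hφ' σ hn₁'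
    rw [ContinuousRep.toTopRep_ρ_apply, hθ, hρG] at h
    have hconj : σ * (⟨(σ : absoluteGaloisGroup K)⁻¹ * n * σ, hNH hn₁⟩ : H) * σ⁻¹ = ⟨n, hNH hn⟩ :=
      Subtype.ext (by simp [mul_assoc])
    rw [hconj] at h
    rw [← muVal_apply, ← h]
  -- the `H`-Kummer condition on `b`
  have hbH : ∀ σ ∈ H, ∃ d : (AlgebraicClosure K)ˣ,
      (∀ n ∈ ramificationSubgroup K S, n • d = d) ∧ σ • b = b * d ^ N := by
    intro σ hσ
    refine ⟨σ • β / β, fun n hn => ?_, ?_⟩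
    · -- `n • (σβ/β) = σβ/β`
      have hn₁ : σ⁻¹ * n * σ ∈ ramificationSubgroup K S := by
        simpa using Subgroup.Normal.conj_mem inferInstance n hn σ⁻¹
      have h1 : n • σ • β = muVal K N (φ ⟨n, hNH hn⟩ - f.1 (1, 1)) * σ • β := by
        rw [← mul_smul, show n * σ = σ * (σ⁻¹ * n * σ) by simp [mul_assoc], mul_smul, hnβ _ hn₁, smul_mul',
          hequiv ⟨σ, hσ⟩ n hn]
      rw [smul_div', h1, hnβ n hn, mul_div_mul_left_eq_div]
    · rw [hb, smul_pow', ← mul_pow, mul_div_cancel]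
  -- §B. radical descent
  obtain ⟨c, d, hc, hd, hbe⟩ := hRD b hbN hbH
  -- `δ := β / d`, an `N'`-th root of `c`
  set δ : (AlgebraicClosure K)ˣ := β / d with hδ
  have hδN' : δ ^ N' = c := by
    have h1 : β ^ N' = b ^ e := by rw [hb, ← pow_mul, hNe]
    rw [hδ, div_pow, h1, hbe, mul_div_cancel_right]
  clear_value δ b
  -- §C. the Kummer cocycle `ψ(σ) = σ(δ)/δ` of `H` in `μ_{N'}` (`δ^{N'} = c ∈ F^×` is `H`-fixed)
  have hψpow : ∀ σ : H, ((σ : absoluteGaloisGroup K) • δ / δ) ^ N' = 1 := fun σ => by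
    rw [div_pow, ← smul_pow', hδN', hc σ σ.2, div_self']
  have hψlc : IsLocallyConstant fun σ : H =>
      muOfUnit K N' ((σ : absoluteGaloisGroup K) • δ / δ) (hψpow σ) := by
    refine IsLocallyConstant.desc _ (muVal K N') ?_ (muVal_injective K N')
    have h1 : (muVal K N' ∘ fun σ : H => muOfUnit K N' ((σ : absoluteGaloisGroup K) • δ / δ) (hψpow σ)) =
        (fun σ : absoluteGaloisGroup K => σ • δ / δ) ∘ (Subtype.val : H → absoluteGaloisGroup K) := by
      funext σ
      rfl
    rw [h1]
    exact ((isLocallyConstant_smul_units K δ).div (IsLocallyConstant.const _)).comp_continuous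
      continuous_subtype_val
  let ψ : C(H, MuCarrier K N') :=
    ⟨fun σ => muOfUnit K N' ((σ : absoluteGaloisGroup K) • δ / δ) (hψpow σ), hψlc.continuous⟩
  have hψval : ∀ σ : H, muVal K N' (ψ σ) = (σ : absoluteGaloisGroup K) • δ / δ := fun σ => rfl
  have hψ : ∀ σ τ : H, ψ (σ * τ) = ψ σ + ρG'.toTopRep.ρ (θ σ) (ψ τ) := fun σ τ => by
    apply muVal_injective K N'
    rw [ContinuousRep.toTopRep_ρ_apply, hθ, hρG', muVal_add, muVal_apply, hψval, hψval, hψval,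
      Subgroup.coe_mul, mul_smul, smul_div' (σ : absoluteGaloisGroup K) ((τ : absoluteGaloisGroup K) • δ) δ,
      mul_comm, div_mul_div_cancel]
  -- on `N_S`: `ψ(n) = n(β)/β = ι(x(n))`
  have hψN : ∀ n : H, θ n = 1 → ψ n = J.hom (φ n - f.1 (1, 1)) := fun n hn => by
    have hn' : (n : absoluteGaloisGroup K) ∈ ramificationSubgroup K S := hθN.1 hn
    apply muVal_injective K N'
    have hφn : x.1 ⟨n, hn'⟩ = φ n - f.1 (1, 1) := hx ⟨n, hn'⟩
    rw [hJ, muVal_muInclusion, hψval, ← hφn, hβ ⟨n, hn'⟩, hδ, smul_div', hd _ hn',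
      div_div_div_cancel_right]
  -- §D. the abstract lemma
  exact cohomologyMap_twoCocycleClass_eq_zero_of_oneCocycle_extension θ hq J f φ hφ' ψ hψ hψN

/-- **MAIN THEOREM (cochain form).**  Same hypotheses: `J ∘ f = ∂b` for a continuous `1`-cochain
`b : Gal(K_S/F) → μ_{N'}` (the shape consumed by cochain-level killing statements, e.g. the finite-stage
interface of the cyclotomic weak Leopoldt assembly). [cite: NeukirchSchmidtWingberg2008, (8.3.11) (ii), (10.3.25)]
[cite: Serre1979, Ch. X §3 b)] -/
theorem exists_twoCoboundary_of_radicalDescent_of_kummer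
    (hH : IsClosed (H : Set (absoluteGaloisGroup K))) (hNH : ramificationSubgroup K S ≤ H)
    {N N' e : ℕ} (hNe : N * e = N')
    (hRD : ∀ b : (AlgebraicClosure K)ˣ, (∀ n ∈ ramificationSubgroup K S, n • b = b) →
      (∀ σ ∈ H, ∃ d : (AlgebraicClosure K)ˣ, (∀ n ∈ ramificationSubgroup K S, n • d = d) ∧ σ • b = b * d ^ N) →
      ∃ c d : (AlgebraicClosure K)ˣ, (∀ σ ∈ H, σ • c = c) ∧ (∀ n ∈ ramificationSubgroup K S, n • d = d) ∧
        b ^ e = c * d ^ N')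
    (hKUM : ∀ x : contOneCocycles ((mu K N).restrict (subgroupIncl (ramificationSubgroup K S))).toTopRep,
      ∃ β : (AlgebraicClosure K)ˣ, ∀ n : ramificationSubgroup K S,
        muVal K N (x.1 n) = (n : absoluteGaloisGroup K) • β / β)
    (ρG : ContinuousRep (galoisGroupAbove S H) ℤ (MuCarrier K N))
    (hρG : ∀ (σ : H) (v : MuCarrier K N),
      ρG ⟨toUnramifiedQuot K S (σ : absoluteGaloisGroup K), coe_mem_galoisGroupAbove S H σ⟩ v =
        mu K N (σ : absoluteGaloisGroup K) v)
    (ρG' : ContinuousRep (galoisGroupAbove S H) ℤ (MuCarrier K N'))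
    (J : ρG.toTopRep ⟶ ρG'.toTopRep) (hJ : ∀ v : MuCarrier K N, J.hom v = muInclusion K ⟨e, hNe.symm⟩ v)
    (f : contTwoCocycles ρG.toTopRep) (φ : C(H, MuCarrier K N))
    (hφ : ∀ σ τ : H,
      f.1 (⟨toUnramifiedQuot K S (σ : absoluteGaloisGroup K), coe_mem_galoisGroupAbove S H σ⟩,
          ⟨toUnramifiedQuot K S (τ : absoluteGaloisGroup K), coe_mem_galoisGroupAbove S H τ⟩) =
        mu K N (σ : absoluteGaloisGroup K) (φ τ) - φ (σ * τ) + φ σ)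
    (hρG' : ∀ (σ : H) (v : MuCarrier K N'),
      ρG' ⟨toUnramifiedQuot K S (σ : absoluteGaloisGroup K), coe_mem_galoisGroupAbove S H σ⟩ v =
        mu K N' (σ : absoluteGaloisGroup K) v) :
    ∃ b : C(galoisGroupAbove S H, MuCarrier K N'), ∀ g h : galoisGroupAbove S H,
      muInclusion K ⟨e, hNe.symm⟩ (f.1 (g, h)) = ρG' g (b h) - b (g * h) + b g := by
  haveI : CompactSpace (galoisGroupAbove S H) := compactSpace_galoisGroupAbove S H hH
  have h0 := cohomologyMap_twoCocycleClass_eq_zero_of_radicalDescent_of_kummer S H hH hNH hNe hRD hKUM ρG hρG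
    ρG' hρG' J hJ f φ hφ
  rw [cohomologyMap_twoCocycleClass, twoCocycleClass_eq_zero_iff] at h0
  obtain ⟨b, hb⟩ := h0
  refine ⟨b, fun g h => ?_⟩
  rw [← hJ, ← pullback₂_id_resIdHom_apply J f g h, hb g h, ContinuousRep.toTopRep_ρ_apply]

/-- **MAIN THEOREM (cochain form, self-contained coefficients).**  As above, with the target action on
`μ_{N'}` built inside: if `N_S` also acts trivially on `μ_{N'}` (e.g. `S ⊇ {v ∣ N'}`), then for every
`2`-cocycle `f` of `Gal(K_S/F)` in `μ_N` (descended action `ρG`) whose inflation `f ∘ (q × q)` to `H`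
is a coboundary `∂φ`, there is a continuous `b : Gal(K_S/F) → μ_{N'}` with
`ι(f(q σ, q τ)) = σ·b(q τ) − b(q(στ)) + b(q σ)` for all `σ, τ ∈ H` — `ι ∘ f = ∂b` for the Galois action
on `μ_{N'}`. [cite: NeukirchSchmidtWingberg2008, (8.3.11) (ii), (10.3.25)] [cite: Serre1979, Ch. X §3 b)] -/
theorem exists_twoCoboundary_of_radicalDescent_of_kummer'
    (hH : IsClosed (H : Set (absoluteGaloisGroup K))) (hNH : ramificationSubgroup K S ≤ H)
    {N N' e : ℕ} (hNe : N * e = N')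
    (hRD : ∀ b : (AlgebraicClosure K)ˣ, (∀ n ∈ ramificationSubgroup K S, n • b = b) →
      (∀ σ ∈ H, ∃ d : (AlgebraicClosure K)ˣ, (∀ n ∈ ramificationSubgroup K S, n • d = d) ∧ σ • b = b * d ^ N) →
      ∃ c d : (AlgebraicClosure K)ˣ, (∀ σ ∈ H, σ • c = c) ∧ (∀ n ∈ ramificationSubgroup K S, n • d = d) ∧
        b ^ e = c * d ^ N')
    (hKUM : ∀ x : contOneCocycles ((mu K N).restrict (subgroupIncl (ramificationSubgroup K S))).toTopRep,
      ∃ β : (AlgebraicClosure K)ˣ, ∀ n : ramificationSubgroup K S,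
        muVal K N (x.1 n) = (n : absoluteGaloisGroup K) • β / β)
    (htriv' : ∀ n ∈ ramificationSubgroup K S, ∀ v : MuCarrier K N', mu K N' n v = v)
    (ρG : ContinuousRep (galoisGroupAbove S H) ℤ (MuCarrier K N))
    (hρG : ∀ (σ : H) (v : MuCarrier K N),
      ρG ⟨toUnramifiedQuot K S (σ : absoluteGaloisGroup K), coe_mem_galoisGroupAbove S H σ⟩ v =
        mu K N (σ : absoluteGaloisGroup K) v)
    (f : contTwoCocycles ρG.toTopRep) (φ : C(H, MuCarrier K N))
    (hφ : ∀ σ τ : H,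
      f.1 (⟨toUnramifiedQuot K S (σ : absoluteGaloisGroup K), coe_mem_galoisGroupAbove S H σ⟩,
          ⟨toUnramifiedQuot K S (τ : absoluteGaloisGroup K), coe_mem_galoisGroupAbove S H τ⟩) =
        mu K N (σ : absoluteGaloisGroup K) (φ τ) - φ (σ * τ) + φ σ) :
    ∃ b : C(galoisGroupAbove S H, MuCarrier K N'), ∀ σ τ : H,
      muInclusion K ⟨e, hNe.symm⟩
          (f.1 (⟨toUnramifiedQuot K S (σ : absoluteGaloisGroup K), coe_mem_galoisGroupAbove S H σ⟩,
            ⟨toUnramifiedQuot K S (τ : absoluteGaloisGroup K), coe_mem_galoisGroupAbove S H τ⟩)) =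
        mu K N' (σ : absoluteGaloisGroup K)
            (b ⟨toUnramifiedQuot K S (τ : absoluteGaloisGroup K), coe_mem_galoisGroupAbove S H τ⟩) -
          b ⟨toUnramifiedQuot K S ((σ * τ : H) : absoluteGaloisGroup K), coe_mem_galoisGroupAbove S H (σ * τ)⟩ +
          b ⟨toUnramifiedQuot K S (σ : absoluteGaloisGroup K), coe_mem_galoisGroupAbove S H σ⟩ := by
  -- the descended action on `μ_{N'}` and the inclusion `J : μ_N → μ_{N'}` over `Gal(K_S/F)`
  obtain ⟨ρ₀', -, hρG'⟩ := exists_continuousRep_galoisGroupAbove_mu S H (N := N') htriv'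
  set ρG' := ρ₀'.restrict (subgroupIncl (galoisGroupAbove S H)) with hρG'def
  let J : ρG.toTopRep ⟶ ρG'.toTopRep :=
    TopRep.ofHom ⟨⟨(muInclusion K ⟨e, hNe.symm⟩).toIntLinearMap, continuous_of_discreteTopology⟩, fun g => by
      ext v
      obtain ⟨σ, rfl⟩ := galoisGroupAbove_mk_surjective S H g
      apply muVal_injective K N'
      change muVal K N' (muInclusion K ⟨e, hNe.symm⟩ (ρG _ v)) = muVal K N' (ρG' _ (muInclusion K ⟨e, hNe.symm⟩ v))
      rw [hρG, hρG', muVal_muInclusion, muVal_apply, muVal_apply, muVal_muInclusion]⟩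
  obtain ⟨b, hb⟩ := exists_twoCoboundary_of_radicalDescent_of_kummer S H hH hNH hNe hRD hKUM ρG hρG ρG' J
    (fun _ => rfl) f φ hφ hρG'
  refine ⟨b, fun σ τ => ?_⟩
  rw [galoisGroupAbove_mk_mul, hb, hρG']

/-- **MAIN THEOREM (class form).**  Under (RD) and (KUM) as in
`cohomologyMap_twoCocycleClass_eq_zero_of_radicalDescent_of_kummer`: every class
`y ∈ H²(Gal(K_S/F), μ_N)` killed by the inflation to `H²(H, μ_N)` (ANY additive `infl` computed on
cocycles by composition with `q × q`, e.g. the one of `exists_inflation₂`) maps to `0` under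
`J_* : H²(Gal(K_S/F), μ_N) → H²(Gal(K_S/F), μ_{N'})` — «`ker(inf²)` dies under `μ_N ↪ μ_{N'}`», the
`Cl_S`-term of NSW (8.3.11) (ii) in the cyclotomic weak Leopoldt argument.
[cite: NeukirchSchmidtWingberg2008, (8.3.11) (ii), (10.3.25)] [cite: Serre1979, Ch. X §3 b)] -/
theorem cohomologyMap_eq_zero_of_inflation_eq_zero_of_radicalDescent_of_kummer
    (hH : IsClosed (H : Set (absoluteGaloisGroup K))) (hNH : ramificationSubgroup K S ≤ H)
    {N N' e : ℕ} (hNe : N * e = N')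
    (hRD : ∀ b : (AlgebraicClosure K)ˣ, (∀ n ∈ ramificationSubgroup K S, n • b = b) →
      (∀ σ ∈ H, ∃ d : (AlgebraicClosure K)ˣ, (∀ n ∈ ramificationSubgroup K S, n • d = d) ∧ σ • b = b * d ^ N) →
      ∃ c d : (AlgebraicClosure K)ˣ, (∀ σ ∈ H, σ • c = c) ∧ (∀ n ∈ ramificationSubgroup K S, n • d = d) ∧
        b ^ e = c * d ^ N')
    (hKUM : ∀ x : contOneCocycles ((mu K N).restrict (subgroupIncl (ramificationSubgroup K S))).toTopRep,
      ∃ β : (AlgebraicClosure K)ˣ, ∀ n : ramificationSubgroup K S,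
        muVal K N (x.1 n) = (n : absoluteGaloisGroup K) • β / β)
    (ρG : ContinuousRep (galoisGroupAbove S H) ℤ (MuCarrier K N))
    (hρG : ∀ (σ : H) (v : MuCarrier K N),
      ρG ⟨toUnramifiedQuot K S (σ : absoluteGaloisGroup K), coe_mem_galoisGroupAbove S H σ⟩ v =
        mu K N (σ : absoluteGaloisGroup K) v)
    (ρG' : ContinuousRep (galoisGroupAbove S H) ℤ (MuCarrier K N'))
    (hρG' : ∀ (σ : H) (v : MuCarrier K N'),
      ρG' ⟨toUnramifiedQuot K S (σ : absoluteGaloisGroup K), coe_mem_galoisGroupAbove S H σ⟩ v =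
        mu K N' (σ : absoluteGaloisGroup K) v)
    (J : ρG.toTopRep ⟶ ρG'.toTopRep) (hJ : ∀ v : MuCarrier K N, J.hom v = muInclusion K ⟨e, hNe.symm⟩ v) :
    haveI : CompactSpace (galoisGroupAbove S H) := compactSpace_galoisGroupAbove S H hH
    ∀ (infl : (continuousCohomology 2 ρG.toTopRep : Type) →+
        (continuousCohomology 2 ((mu K N).restrict (subgroupIncl H)).toTopRep : Type)),
      (∀ (f : contTwoCocycles ρG.toTopRep) (F : contTwoCocycles ((mu K N).restrict (subgroupIncl H)).toTopRep),
        (∀ σ τ : H, F.1 (σ, τ) =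
          f.1 (⟨toUnramifiedQuot K S (σ : absoluteGaloisGroup K), coe_mem_galoisGroupAbove S H σ⟩,
            ⟨toUnramifiedQuot K S (τ : absoluteGaloisGroup K), coe_mem_galoisGroupAbove S H τ⟩)) →
        infl (twoCocycleClass _ f) = twoCocycleClass _ F) →
      ∀ y : continuousCohomology 2 ρG.toTopRep, infl y = 0 → cohomologyMap J 2 y = 0 := by
  haveI : CompactSpace (absoluteGaloisGroup K) := absoluteGaloisGroup_compactSpace K
  haveI : CompactSpace H := isCompact_iff_compactSpace.mp hH.isCompact
  haveI : CompactSpace (galoisGroupAbove S H) := compactSpace_galoisGroupAbove S H hH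
  intro infl hinfl y hy
  obtain ⟨f, rfl⟩ := twoCocycleClass_surjective _ y
  obtain ⟨F, hF⟩ := exists_twoCocycle_inflate S H ρG hρG f
  rw [hinfl f F hF] at hy
  obtain ⟨φ, hφ⟩ := (twoCocycleClass_eq_zero_iff _ F).1 hy
  refine cohomologyMap_twoCocycleClass_eq_zero_of_radicalDescent_of_kummer S H hH hNH hNe hRD hKUM ρG hρG
    ρG' hρG' J hJ f φ fun σ τ => ?_
  rw [← hF σ τ, hφ σ τ, ContinuousRep.toTopRep_ρ_apply, ContinuousRep.restrict_apply, subgroupIncl_apply]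

end Literature.NumberTheory.GaloisRepresentations

end
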